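import Summits.NavierStokesRegularity.NavierStokesRegularity.Theorems.SoloSalvageWu2026Reduced
import Summits.NavierStokesRegularity.NavierStokesRegularity.Theorems.SoloSalvageWu2026DivCurl
import Summits.NavierStokesRegularity.NavierStokesRegularity.Theorems.SoloSalvageWu2026RadialFlux
import HarnessLib

/-!
# C177 `Wu2026` — TRUE column: Theorem 1.1 from the SIX steps not yet ported

D-0090 NS-CLAIMS sweep, claim C177 (W. Wu, arXiv:2608.22471v1), skeleton
`Literature/Claims/NS/Wu2026.lean` (rev 2 p560520). The composition `claim_of_steps''` of the
skeleton has twelve analytic binders; the tree now PROVES six of them — (3.4)–(3.8) `step_38`,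
(3.18) `step_318`, (3.86) `step_386`, (3.87) `step_387` (salvage-p3 g6), (3.3) `step_33` and
Prop 3.4 `step_P34` (salvage-p1 g5) — plus Lemma 3.1 and the `D = 0` case in-file. This file feeds
them in: Theorem 1.1 / the tree's named fact `Wu2026_thm11` / Cor 1.2 follow from the six remaining
OPEN steps `Step_L21` (Lemma 2.1), `Step_341` (§3.3 canonical pressure), `Step_construct` (§3.2–§3.4
tangent construction), `Step_P33` (Prop 3.3), `Step_382` ((3.72)–(3.82)), `Step_385` ((3.83)–(3.85)).
Records, not a verdict (row #164 lettered «discharges»; the named fact's stature is unchanged until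
every binder is a theorem).

WHAT THIS IS NOT: not a claim about NS regularity or blow-up; not a claim about any author beyond
the typed locator.
-/

noncomputable section

set_option linter.dupNamespace false

namespace Summit.NavierStokesRegularity.NavierStokesRegularity.Theorems.Wu2026Salvage

open Literature.Claims.NS.Wu2026

/-- **Theorem 1.1 of arXiv:2608.22471v1 from the six steps not yet ported** (Lemma 2.1, §3.3,
§3.2–§3.4 tangent construction, Prop 3.3, (3.72)–(3.82), (3.83)–(3.85)); (3.3), (3.4)–(3.8),
Lemma 3.1, (3.18), Prop 3.4, (3.86), (3.87) and the `D = 0` case are kernel theorems.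
[cite: Wu2026, Thm 1.1 p.2 l.30–37; proof §3 p.7–26] -/
theorem claimedTheorem_of_six_open_steps (h21 : Step_L21) (h341 : Step_341)
    (hcon : Step_construct) (hP33 : Step_P33) (h382 : Step_382) (h385 : Step_385) :
    ClaimedTheorem :=
  claimedTheorem_of_open_steps h21 step_33 h341 hcon hP33 step_P34 h382 h385

/-- The same for the tree's named fact: `Wu2026_thm11` from the six open steps.
[cite: Wu2026, Thm 1.1 p.2 l.30–37] -/
theorem wu2026_thm11_of_six_open_steps (h21 : Step_L21) (h341 : Step_341)
    (hcon : Step_construct) (hP33 : Step_P33) (h382 : Step_382) (h385 : Step_385) :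
    Literature.Analysis.FluidPDE.Wu2026_thm11 :=
  claimedTheorem_of_six_open_steps h21 h341 hcon hP33 h382 h385

/-- And Corollary 1.2 from the six open steps (via the tree's PROVED `Wu2026_cor12_of_thm11`).
[cite: Wu2026, Cor 1.2 p.2 l.42–56] -/
theorem wu2026_cor12_of_six_open_steps (h21 : Step_L21) (h341 : Step_341)
    (hcon : Step_construct) (hP33 : Step_P33) (h382 : Step_382) (h385 : Step_385) :
    Literature.Analysis.FluidPDE.Wu2026_cor12 :=
  claimedCor_of_claimedTheorem (claimedTheorem_of_six_open_steps h21 h341 hcon hP33 h382 h385)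

end Summit.NavierStokesRegularity.NavierStokesRegularity.Theorems.Wu2026Salvage

-- WHAT THIS IS NOT: not a claim about NS regularity or blow-up; not a claim about any author beyond the typed locator.
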